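import Literature.Analysis.Convexity.AnisotropicPerimeterTransform
import Literature.Analysis.Convexity.AnisotropicPerimeterSubmodular
import HarnessLib

/-!
# Sets of finite perimeter are stable under translations, isometries, dilations, reflections and Boolean operations

Topic `Literature/Analysis/Convexity`; namespace `Literature.Analysis.Convexity` (dot-notation lemmas are
placed on `Literature.MathematicalPhysics.StatisticalMechanics.HasFinitePerimeter`, the tree's Caccioppoli-set
predicate `HasFinitePerimeter A := MeasurableSet A ∧ perimeter A < ∞` of `FccTexturedSet.lean`).

The tree already has the VALUE rules for De Giorgi's perimeter under affine maps
(`AnisotropicPerimeterTransform.lean`: `perimeter_vadd`, `perimeter_image_linearIsometryEquiv`,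
`perimeter_smul` for `r > 0`), the complement rule (`AnisotropicPerimeterComplement.lean`:
`perimeter_compl`) and submodularity (`AnisotropicPerimeterSubmodular.lean`: Maggi's Lemma 12.22).  This file
packages them as CLOSURE rules of the predicate `HasFinitePerimeter` — the bookkeeping a consumer needs when a
whole finite-perimeter TEXTURE is translated / rotated / dilated (e.g. the dilation `G ↦ λ • G`, `λ = (N′/N)^{1/3}`,
of the saturation reduction of a polycrystalline competitor) — together with the value rules for reflections
and dilations of either sign and the finiteness of the volume of a dilate:

* `HasFinitePerimeter.vadd`, `hasFinitePerimeter_vadd_iff` — translations;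
* `HasFinitePerimeter.image_linearIsometryEquiv` — linear isometries;
* `perimeter_neg`, `HasFinitePerimeter.neg` — the reflection `A ↦ -A`;
* `HasFinitePerimeter.smul` (`r > 0`), `perimeter_smul_of_ne_zero` (`Per(rA) = |r|^{d-1} Per(A)`, `r ≠ 0`),
  `HasFinitePerimeter.smul_of_ne_zero`, `hasFinitePerimeter_smul_iff` — dilations;
* `volume_smul_set_lt_top`, `volume_smul_set_lt_top_iff` — `vol(rA) = |r|^d vol(A)` stays finite;
* `HasFinitePerimeter.union_of_disjoint`, `hasFinitePerimeter_iUnion_of_pairwise_disjoint` (any `V`, no volume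
  hypothesis), and on `ℝⁿ`: `HasFinitePerimeter.compl`, `.union`, `.inter`, `.diff` (finite volumes, via
  Maggi's Lemma 12.22).

All statements are immediate consequences of the cited value rules; nothing here is new mathematics.

## References
* F. Maggi, *Sets of Finite Perimeter and Geometric Variational Problems*, CUP 2012: Exercise 12.8 and
  Exercise 12.11 p. 123 (translations, dilations, isometries), Lemma 12.22 p. 130 (union / intersection),
  Exercise 12.9 / Remark 12.4 (complements). [`Maggi2012`]
* L. C. Evans, R. F. Gariepy, *Measure Theory and Fine Properties of Functions*, revised ed., CRC 2015,
  Definition 5.1 (sets of finite perimeter). [`EvansGariepy2015`]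
-/

noncomputable section

open Set Filter Function Metric
open _root_.MeasureTheory _root_.MeasureTheory.Measure
open scoped ENNReal NNReal Topology Pointwise

namespace Literature.Analysis.Convexity

open Literature.MathematicalPhysics.StatisticalMechanics (fieldDivergence perimeter HasFinitePerimeter)

variable {V : Type*} [NormedAddCommGroup V] [InnerProductSpace ℝ V] [FiniteDimensional ℝ V]
  [MeasurableSpace V] [BorelSpace V]

/-! ### Translations -/

/-- A translate of a set of finite perimeter has finite perimeter (`Per(a + A) = Per(A)`).
[cite: Maggi2012, Exercise 12.8 p. 123] -/
theorem _root_.Literature.MathematicalPhysics.StatisticalMechanics.HasFinitePerimeter.vadd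
    {A : Set V} (h : HasFinitePerimeter A) (a : V) : HasFinitePerimeter (a +ᵥ A) := by
  refine ⟨?_, by rw [perimeter_vadd]; exact h.2⟩
  have hset : a +ᵥ A = (Homeomorph.addLeft a) '' A := by
    rw [← Set.image_vadd]; rfl
  rw [hset]
  exact (Homeomorph.addLeft a).measurableEmbedding.measurableSet_image.2 h.1

/-- `a + A` has finite perimeter iff `A` has. [cite: Maggi2012, Exercise 12.8 p. 123] -/
theorem hasFinitePerimeter_vadd_iff {A : Set V} (a : V) :
    HasFinitePerimeter (a +ᵥ A) ↔ HasFinitePerimeter A := by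
  refine ⟨fun h => ?_, fun h => h.vadd a⟩
  have h' := h.vadd (-a)
  rwa [neg_vadd_vadd] at h'

/-! ### Linear isometries -/

/-- The image of a set of finite perimeter under a linear isometry has finite perimeter
(`Per(Q E) = Per(E)`, `Q ∈ O(n)`). [cite: Maggi2012, Exercise 12.11 p. 123] -/
theorem _root_.Literature.MathematicalPhysics.StatisticalMechanics.HasFinitePerimeter.image_linearIsometryEquiv
    {A : Set V} (h : HasFinitePerimeter A) (g : V ≃ₗᵢ[ℝ] V) : HasFinitePerimeter (g '' A) := by
  refine ⟨?_, by rw [perimeter_image_linearIsometryEquiv]; exact h.2⟩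
  have hset : g '' A = g.toHomeomorph '' A := rfl
  rw [hset]
  exact g.toHomeomorph.measurableEmbedding.measurableSet_image.2 h.1

/-! ### Reflection through the origin -/

omit [FiniteDimensional ℝ V] [MeasurableSpace V] [BorelSpace V] in
/-- `-A` is the image of `A` under the linear isometry `-id`. [folklore] -/
private theorem neg_eq_image_linearIsometryEquiv_neg (A : Set V) :
    -A = (LinearIsometryEquiv.neg ℝ : V ≃ₗᵢ[ℝ] V) '' A := by
  ext x
  simp only [Set.mem_neg, Set.mem_image, LinearIsometryEquiv.coe_neg]
  constructor
  · intro hx; exact ⟨-x, hx, neg_neg x⟩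
  · rintro ⟨y, hy, rfl⟩; simpa using hy

/-- `Per(-A) = Per(A)` (the case `Q = -id ∈ O(n)` of isometry invariance).
[cite: Maggi2012, Exercise 12.11 p. 123] -/
theorem perimeter_neg (A : Set V) : perimeter (-A) = perimeter A := by
  rw [neg_eq_image_linearIsometryEquiv_neg, perimeter_image_linearIsometryEquiv]

/-- The reflection `-A` of a set of finite perimeter has finite perimeter.
[cite: Maggi2012, Exercise 12.11 p. 123] -/
theorem _root_.Literature.MathematicalPhysics.StatisticalMechanics.HasFinitePerimeter.neg
    {A : Set V} (h : HasFinitePerimeter A) : HasFinitePerimeter (-A) := by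
  rw [neg_eq_image_linearIsometryEquiv_neg]
  exact h.image_linearIsometryEquiv _

/-! ### Dilations -/

/-- A positive dilate of a set of finite perimeter has finite perimeter (`Per(rA) = r^{d-1} Per(A)`).
[cite: Maggi2012, Exercise 12.8 p. 123] -/
theorem _root_.Literature.MathematicalPhysics.StatisticalMechanics.HasFinitePerimeter.smul
    {A : Set V} (h : HasFinitePerimeter A) {r : ℝ} (hr : 0 < r) : HasFinitePerimeter (r • A) :=
  ⟨h.1.const_smul₀ r, by
    rw [perimeter_smul A hr]
    exact ENNReal.mul_lt_top ENNReal.ofReal_lt_top h.2⟩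

omit [FiniteDimensional ℝ V] [MeasurableSpace V] [BorelSpace V] in
/-- `rA = (-r)(-A)`. [folklore] -/
private theorem smul_set_eq_neg_smul_neg (r : ℝ) (A : Set V) : r • A = (-r) • (-A) := by
  rw [Set.smul_set_neg, Set.neg_smul_set, neg_neg]

/-- **Dilation law for either sign: `Per(rA) = |r|^{d-1} Per(A)`** (`r ≠ 0`, `d = dim V`); for `r < 0`
combine the positive law with the reflection `-id ∈ O(n)`.
[cite: Maggi2012, Exercise 12.8 and Exercise 12.11 p. 123] -/
theorem perimeter_smul_of_ne_zero (A : Set V) {r : ℝ} (hr : r ≠ 0) :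
    perimeter (r • A) = ENNReal.ofReal (|r| ^ (Module.finrank ℝ V - 1)) * perimeter A := by
  rcases lt_or_gt_of_ne hr with hneg | hpos
  · rw [smul_set_eq_neg_smul_neg, perimeter_smul _ (neg_pos.2 hneg), perimeter_neg, abs_of_neg hneg]
  · rw [perimeter_smul _ hpos, abs_of_pos hpos]

/-- A nonzero dilate of a set of finite perimeter has finite perimeter.
[cite: Maggi2012, Exercise 12.8 p. 123] -/
theorem _root_.Literature.MathematicalPhysics.StatisticalMechanics.HasFinitePerimeter.smul_of_ne_zero
    {A : Set V} (h : HasFinitePerimeter A) {r : ℝ} (hr : r ≠ 0) : HasFinitePerimeter (r • A) :=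
  ⟨h.1.const_smul₀ r, by
    rw [perimeter_smul_of_ne_zero A hr]
    exact ENNReal.mul_lt_top ENNReal.ofReal_lt_top h.2⟩

/-- `rA` has finite perimeter iff `A` has (`r ≠ 0`). [cite: Maggi2012, Exercise 12.8 p. 123] -/
theorem hasFinitePerimeter_smul_iff {A : Set V} {r : ℝ} (hr : r ≠ 0) :
    HasFinitePerimeter (r • A) ↔ HasFinitePerimeter A := by
  refine ⟨fun h => ?_, fun h => h.smul_of_ne_zero hr⟩
  have h' := h.smul_of_ne_zero (inv_ne_zero hr)
  rwa [inv_smul_smul₀ hr] at h'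

/-- `vol(rA) = |r|^d vol(A)` is finite when `vol(A)` is. [cite: Maggi2012, Exercise 12.8 p. 123 — plumbing] -/
theorem volume_smul_set_lt_top {A : Set V} (hA : volume A < ⊤) (r : ℝ) : volume (r • A) < ⊤ := by
  rw [Measure.addHaar_smul]
  exact ENNReal.mul_lt_top ENNReal.ofReal_lt_top hA

/-- `vol(rA) < ∞ ↔ vol(A) < ∞` for `r ≠ 0`. [cite: Maggi2012, Exercise 12.8 p. 123 — plumbing] -/
theorem volume_smul_set_lt_top_iff {A : Set V} {r : ℝ} (hr : r ≠ 0) :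
    volume (r • A) < ⊤ ↔ volume A < ⊤ := by
  refine ⟨fun h => ?_, fun h => volume_smul_set_lt_top h r⟩
  have h' := volume_smul_set_lt_top h r⁻¹
  rwa [inv_smul_smul₀ hr] at h'

/-- `(vol(rA)).toReal = |r|^d (vol A).toReal`. [cite: Maggi2012, Exercise 12.8 p. 123 — plumbing] -/
theorem toReal_volume_smul_set (A : Set V) (r : ℝ) :
    (volume (r • A)).toReal = |r| ^ Module.finrank ℝ V * (volume A).toReal := by
  rw [Measure.addHaar_smul, abs_pow, ENNReal.toReal_mul, ENNReal.toReal_ofReal (pow_nonneg (abs_nonneg r) _)]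

/-! ### Disjoint unions (any `V`, no volume hypothesis) -/

/-- The union of two DISJOINT sets of finite perimeter has finite perimeter
(`Per(A ∪ B) ≤ Per(A) + Per(B)`). [cite: Maggi2012, Lemma 12.22 p. 130 (disjoint case)] -/
theorem _root_.Literature.MathematicalPhysics.StatisticalMechanics.HasFinitePerimeter.union_of_disjoint
    {A B : Set V} (hA : HasFinitePerimeter A) (hB : HasFinitePerimeter B) (hAB : Disjoint A B) :
    HasFinitePerimeter (A ∪ B) := by
  refine ⟨hA.1.union hB.1, ?_⟩
  rw [perimeter_eq_anisotropicPerimeter_closedBall]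
  refine lt_of_le_of_lt (anisotropicPerimeter_union_le _ hB.1 hAB) ?_
  rw [← perimeter_eq_anisotropicPerimeter_closedBall, ← perimeter_eq_anisotropicPerimeter_closedBall]
  exact ENNReal.add_lt_top.2 ⟨hA.2, hB.2⟩

/-- A finite pairwise-disjoint union of sets of finite perimeter has finite perimeter
(`Per(⋃ Aᵢ) ≤ Σ Per(Aᵢ)`). [cite: Maggi2012, Lemma 12.22 p. 130 (disjoint case)] -/
theorem hasFinitePerimeter_iUnion_of_pairwise_disjoint {ι : Type*} [Fintype ι] {A : ι → Set V}
    (hA : ∀ i, HasFinitePerimeter (A i)) (hd : Pairwise fun i j => Disjoint (A i) (A j)) :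
    HasFinitePerimeter (⋃ i, A i) := by
  refine ⟨MeasurableSet.iUnion fun i => (hA i).1, ?_⟩
  rw [perimeter_eq_anisotropicPerimeter_closedBall]
  refine lt_of_le_of_lt (anisotropicPerimeter_iUnion_le_sum _ (fun i => (hA i).1) hd) ?_
  refine ENNReal.sum_lt_top.2 fun i _ => ?_
  rw [← perimeter_eq_anisotropicPerimeter_closedBall]
  exact (hA i).2

/-! ### Boolean operations on `ℝⁿ` -/

section Euclidean

variable {n : ℕ}

/-- The complement of a set of finite perimeter has finite perimeter (`Per(Aᶜ) = Per(A)`).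
[cite: Maggi2012, Exercise 12.9 p. 123 (complement), with Remark 12.4] -/
theorem _root_.Literature.MathematicalPhysics.StatisticalMechanics.HasFinitePerimeter.compl
    {A : Set (EuclideanSpace ℝ (Fin n))} (h : HasFinitePerimeter A) : HasFinitePerimeter Aᶜ :=
  ⟨h.1.compl, by rw [perimeter_compl h.1]; exact h.2⟩

/-- `Aᶜ` has finite perimeter iff `A` has. [cite: Maggi2012, Exercise 12.9 p. 123] -/
theorem hasFinitePerimeter_compl_iff {A : Set (EuclideanSpace ℝ (Fin n))} :
    HasFinitePerimeter Aᶜ ↔ HasFinitePerimeter A :=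
  ⟨fun h => by simpa using h.compl, fun h => h.compl⟩

/-- Sets of finite perimeter AND finite volume are closed under union (no disjointness).
[cite: Maggi2012, Lemma 12.22 p. 130] -/
theorem _root_.Literature.MathematicalPhysics.StatisticalMechanics.HasFinitePerimeter.union
    {E F : Set (EuclideanSpace ℝ (Fin n))} (hE : HasFinitePerimeter E) (hEv : volume E < ⊤)
    (hF : HasFinitePerimeter F) (hFv : volume F < ⊤) : HasFinitePerimeter (E ∪ F) :=
  ⟨hE.1.union hF.1, perimeter_union_lt_top' hE.1 hEv hF.1 hFv hE.2 hF.2⟩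

/-- Sets of finite perimeter and finite volume are closed under intersection.
[cite: Maggi2012, Lemma 12.22 p. 130] -/
theorem _root_.Literature.MathematicalPhysics.StatisticalMechanics.HasFinitePerimeter.inter
    {E F : Set (EuclideanSpace ℝ (Fin n))} (hE : HasFinitePerimeter E) (hEv : volume E < ⊤)
    (hF : HasFinitePerimeter F) (hFv : volume F < ⊤) : HasFinitePerimeter (E ∩ F) :=
  ⟨hE.1.inter hF.1, perimeter_inter_lt_top hE.1 hEv hF.1 hFv hE.2 hF.2⟩

/-- Sets of finite perimeter and finite volume are closed under set difference:
`(E ∖ F)ᶜ = Eᶜ ⊔ (E ∩ F)` is a disjoint union, so `Per(E ∖ F) ≤ Per(E) + Per(E ∩ F) < ∞`.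
[cite: Maggi2012, Lemma 12.22 p. 130 (with Exercise 12.9, complements)] -/
theorem _root_.Literature.MathematicalPhysics.StatisticalMechanics.HasFinitePerimeter.diff
    {E F : Set (EuclideanSpace ℝ (Fin n))} (hE : HasFinitePerimeter E) (hEv : volume E < ⊤)
    (hF : HasFinitePerimeter F) (hFv : volume F < ⊤) : HasFinitePerimeter (E \ F) := by
  have hc : (E \ F)ᶜ = Eᶜ ∪ (E ∩ F) := by
    ext x
    simp only [Set.mem_compl_iff, Set.mem_sdiff, not_and, not_not, Set.mem_union, Set.mem_inter_iff]
    tauto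
  have hdisj : Disjoint Eᶜ (E ∩ F) :=
    Set.disjoint_left.2 fun x hx hx' => hx hx'.1
  have h : HasFinitePerimeter (E \ F)ᶜ := by
    rw [hc]
    exact hE.compl.union_of_disjoint (hE.inter hEv hF hFv) hdisj
  exact hasFinitePerimeter_compl_iff.1 h

end Euclidean

end Literature.Analysis.Convexity

end
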